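import Literature.NumberTheory.GaloisRepresentations.ArtinConductorIntegrality
import Mathlib.RepresentationTheory.Subrepresentation
import Mathlib.RepresentationTheory.Invariants
import Mathlib.GroupTheory.SemidirectProduct
import Mathlib.GroupTheory.QuotientGroup.Basic
import Mathlib.Tactic.Group
import Mathlib.LinearAlgebra.Eigenspace.Triangularizable
import Mathlib.FieldTheory.IsAlgClosed.Basic
import Mathlib.FieldTheory.IsAlgClosed.AlgebraicClosure
import Mathlib.LinearAlgebra.TensorProduct.Tower
import Mathlib.RingTheory.TensorProduct.Finite
import Mathlib.RingTheory.Flat.Basic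
import Mathlib.LinearAlgebra.Projection
import Mathlib.LinearAlgebra.Dimension.Constructions
import HarnessLib

/-!
# Integrality of weighted codimensions across a cyclic extension (trunk GalRep, item C10 support)

Pure representation theory behind the integrality of the Swan conductor for a representation
whose restriction to wild inertia factors through a finite quotient while the full inertia group
may act through an infinite image (the situation of Katz, *Gauss sums, Kloosterman sums and
monodromy groups* (1988), Ch. 1, 1.8–1.10, for `ℓ`-adic or abstract coefficients).  Let `G` be a
group, `N ⊲ G` a normal subgroup with `G = N⟨s⟩` and `s ^ k ∈ N ↔ e ∣ k` (`G/N` cyclic of order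
`e`, generated by `s`), and let `b(τ) = Σ_i c_i · codim F^{τ(H_i)}` be a non-negative combination
of codimensions of fixed spaces of finite subgroups `H_i ≤ N` of order invertible in the field of
coefficients (for the Swan conductor: `G = G_0`, `N = G_1`, `H_i = G_i`, `c_i = #G_i/#G_0`).

* `Literature.RepresentationTheory.FiniteGroups.MonoidHom.exists_extend_of_cyclic_quotient` — **extension across a cyclic quotient**: a
  homomorphism `τ : N →* T` together with `S : T` conjugating `τ` as `s` does and with
  `S ^ e = τ(s ^ e)` extends to `Θ : G →* T` with `Θ s = S` (the group-theoretic skeleton of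
  Isaacs, *Character Theory of Finite Groups*, Thm 11.22: invariant characters extend across cyclic
  quotients); `Literature.RepresentationTheory.FiniteGroups.SemidirectProduct.exists_lift_of_conj` — without the power condition one still
  gets a homomorphism of `N ⋊_s ℤ` (`Literature.zpowConj N s` is the conjugation action of `ℤ` through
  `s`).
* `Literature.RepresentationTheory.FiniteGroups.Representation.codimFixed_eq_add` — **additivity** of `codim F^H` (`H` finite of invertible
  order) along a subrepresentation and its quotient (exactness of `H`-invariants by averaging).
* `Literature.RepresentationTheory.FiniteGroups.Representation.codimFixed_baseChange'` — **invariance under extension of scalars** of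
  `codim F^H` (the fixed space is the range of Mathlib's averaging projector
  `Representation.averageMap`, an idempotent whose rank is unchanged; `Literature.RepresentationTheory.FiniteGroups.Representation.baseChange'`
  is extension of scalars of an abstract representation, absent from Mathlib for `Representation`).
* `Literature.RepresentationTheory.FiniteGroups.clifford_integrality_of_isAlgClosed`, `Literature.RepresentationTheory.FiniteGroups.clifford_integrality` — **the transfer theorem**:
  if `b(Θ|_N) ∈ ℕ` for every finite-dimensional representation `Θ` of `G` (Artin's theorem in the
  application), then `b(ρ ∘ inl) ∈ ℕ` for every finite-dimensional representation `ρ` of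
  `N ⋊_s ℤ` (over any field; the hypothesis is used over the algebraic closure).  Proof: the
  element `z₀ = inl(s^e)⁻¹ · inr(e)` is central in `N ⋊_s ℤ`; by induction on the dimension, split
  off an eigenspace of `ρ z₀` (a subrepresentation) and use additivity, and when `ρ z₀ = μ` is a
  scalar rescale `ρ(inr 1)` by an `e`-th root of `μ⁻¹` and extend `ρ ∘ inl` to `G`.

All statements are proved (no named facts).  The Galois-theoretic application is
`Literature/NumberTheory/GaloisRepresentations/ArtinConductorWildProofs.lean`.

## References

* I. M. Isaacs, *Character Theory of Finite Groups* (1976), Ch. 11, Thm 11.22 (extension of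
  invariant characters across cyclic quotients) — context for the extension lemma.
* J.-P. Serre, *Linear Representations of Finite Groups* (1977), §19.3 (the invariant `b(M)`);
  N. Katz, *Gauss sums, Kloosterman sums, and monodromy groups* (1988), Ch. 1, 1.8–1.10.
-/

noncomputable section

/-! ### Extension of homomorphisms across a cyclic quotient -/

namespace Literature.RepresentationTheory.FiniteGroups

open Multiplicative

variable {G T : Type*} [Group G] [Group T]

/-- Conjugation by powers of `s` on a normal subgroup `N`, as an action `ℤ → Aut N`
(`k ↦ (n ↦ s^k n s^{-k})`); the structure map of the semidirect product `N ⋊_s ℤ`.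
Ref: Isaacs, *Character Theory of Finite Groups* (1976), proof of Thm 11.22. [folklore] -/
noncomputable def zpowConj (N : Subgroup G) [N.Normal] (s : G) : Multiplicative ℤ →* MulAut N :=
  (MulAut.conjNormal : G →* MulAut N).comp (zpowersHom G s)

/-- `zpowConj N s k n = s^k n s^{-k}`. [folklore] -/
theorem zpowConj_apply_coe (N : Subgroup G) [N.Normal] (s : G) (k : Multiplicative ℤ) (n : N) :
    ((zpowConj N s k) n : G) = s ^ k.toAdd * n * (s ^ k.toAdd)⁻¹ := by
  change ((MulAut.conjNormal (s ^ k.toAdd) : MulAut N) n : G) = _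
  exact MulAut.conjNormal_apply _ _

/-- Compatibility of `τ` with conjugation by all powers of `s`, from the case of `s` itself.
Ref: Isaacs, *Character Theory of Finite Groups* (1976), proof of Thm 11.22. [folklore] -/
theorem conj_zpow_of_conj (N : Subgroup G) [hN : N.Normal] (s : G) (τ : N →* T) (S : T)
    (hconj : ∀ n : N, S * τ n * S⁻¹ = τ ⟨s * n * s⁻¹, hN.conj_mem _ n.2 s⟩) (k : ℤ) (n : N) :
    τ ⟨s ^ k * n * (s ^ k)⁻¹, hN.conj_mem _ n.2 _⟩ = S ^ k * τ n * (S ^ k)⁻¹ := by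
  have hmem : ∀ (k : ℤ) (n : N), s ^ k * n * (s ^ k)⁻¹ ∈ N := fun k n => hN.conj_mem _ n.2 _
  revert n
  induction k using Int.induction_on with
  | zero => intro n; simp
  | succ k ih =>
    intro n
    have h1 : s ^ ((k : ℤ) + 1) * n * (s ^ ((k : ℤ) + 1))⁻¹ =
        s * (s ^ (k : ℤ) * n * (s ^ (k : ℤ))⁻¹) * s⁻¹ := by
      rw [zpow_add_one]; group
    have h2 := hconj ⟨s ^ (k : ℤ) * n * (s ^ (k : ℤ))⁻¹, hmem k n⟩
    rw [ih n] at h2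
    have h3 : (⟨s ^ ((k : ℤ) + 1) * n * (s ^ ((k : ℤ) + 1))⁻¹, hmem _ n⟩ : N) =
        ⟨s * ((⟨s ^ (k : ℤ) * n * (s ^ (k : ℤ))⁻¹, hmem k n⟩ : N) : G) * s⁻¹,
          hN.conj_mem _ (hmem k n) s⟩ := Subtype.ext h1
    rw [h3, ← h2, zpow_add_one]
    group
  | pred k ih =>
    intro n
    have hmem' : ∀ m : N, s⁻¹ * m * s ∈ N := fun m => by
      simpa using hN.conj_mem _ m.2 s⁻¹
    have hinv : ∀ m : N, S⁻¹ * τ m * S = τ ⟨s⁻¹ * m * s, hmem' m⟩ := by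
      intro m
      have h2 := hconj ⟨s⁻¹ * m * s, hmem' m⟩
      have hm : (⟨s * ((⟨s⁻¹ * m * s, hmem' m⟩ : N) : G) * s⁻¹,
          hN.conj_mem _ (hmem' m) s⟩ : N) = m := Subtype.ext (by simp; group)
      rw [hm] at h2
      rw [← h2]; group
    have h1 : s ^ (-(k : ℤ) - 1) * n * (s ^ (-(k : ℤ) - 1))⁻¹ =
        s⁻¹ * (s ^ (-(k : ℤ)) * n * (s ^ (-(k : ℤ)))⁻¹) * s := by
      rw [zpow_sub_one]; group
    have h2 := hinv ⟨s ^ (-(k : ℤ)) * n * (s ^ (-(k : ℤ)))⁻¹, hmem _ n⟩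
    rw [ih n] at h2
    have h3 : (⟨s ^ (-(k : ℤ) - 1) * n * (s ^ (-(k : ℤ) - 1))⁻¹, hmem _ n⟩ : N) =
        ⟨s⁻¹ * ((⟨s ^ (-(k : ℤ)) * n * (s ^ (-(k : ℤ)))⁻¹, hmem _ n⟩ : N) : G) * s,
          hmem' _⟩ := Subtype.ext h1
    rw [h3, ← h2, zpow_sub_one]
    group

/-- **Lift to the semidirect product.**  A homomorphism `τ : N →* T` and an element `S : T` with
`S τ(n) S⁻¹ = τ(s n s⁻¹)` give a homomorphism `Θ : N ⋊_s ℤ →* T` with `Θ ∘ inl = τ` and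
`Θ (inr k) = S ^ k` (universal property of the semidirect product).
Ref: Isaacs, *Character Theory of Finite Groups* (1976), proof of Thm 11.22. [folklore] -/
theorem SemidirectProduct.exists_lift_of_conj (N : Subgroup G) [hN : N.Normal] (s : G)
    (τ : N →* T) (S : T)
    (hconj : ∀ n : N, S * τ n * S⁻¹ = τ ⟨s * n * s⁻¹, hN.conj_mem _ n.2 s⟩) :
    ∃ Θ : N ⋊[zpowConj N s] Multiplicative ℤ →* T,
      (∀ n : N, Θ (SemidirectProduct.inl n) = τ n) ∧
        ∀ k : Multiplicative ℤ, Θ (SemidirectProduct.inr k) = S ^ k.toAdd := by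
  have hφ : ∀ (k : Multiplicative ℤ) (n : N), (zpowConj N s k n : N) =
      ⟨s ^ k.toAdd * n * (s ^ k.toAdd)⁻¹, hN.conj_mem _ n.2 _⟩ := fun k n =>
    Subtype.ext (zpowConj_apply_coe N s k n)
  refine ⟨SemidirectProduct.lift τ (zpowersHom T S) (fun k => ?_), fun n => by simp, fun k => by simp⟩
  ext n
  simp only [MonoidHom.coe_comp, MulEquiv.coe_toMonoidHom, Function.comp_apply,
    MulAut.conj_apply, zpowersHom_apply]
  rw [hφ, conj_zpow_of_conj N s τ S hconj]

/-- **Extension across a cyclic quotient.**  Let `N ⊲ G` with `G = N⟨s⟩` (`hgen`) and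
`s ^ k ∈ N ↔ e ∣ k` (`hord`: the image of `s` generates `G/N`, of order `e`).  A homomorphism
`τ : N →* T` and `S : T` with `S τ(n) S⁻¹ = τ(s n s⁻¹)` and `S ^ e = τ(s ^ e)` extend to a
homomorphism `Θ : G →* T` with `Θ|_N = τ` and `Θ s = S` (`G` is the quotient of `N ⋊_s ℤ` by
the normal subgroup generated by `inl(s^e)⁻¹ inr(e)`, on which the lift of `(τ, S)` is trivial).
This is the group-theoretic skeleton of the extendibility of invariant representations across
cyclic quotients.  Ref: Isaacs, *Character Theory of Finite Groups* (1976), Thm 11.22 and its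
proof. [folklore] -/
theorem MonoidHom.exists_extend_of_cyclic_quotient (N : Subgroup G) [hN : N.Normal] (s : G) (e : ℕ)
    (hgen : ∀ g : G, ∃ (k : ℤ) (n : G), n ∈ N ∧ g = n * s ^ k)
    (hord : ∀ k : ℤ, s ^ k ∈ N ↔ (e : ℤ) ∣ k)
    (τ : N →* T) (S : T)
    (hconj : ∀ n : N, S * τ n * S⁻¹ = τ ⟨s * n * s⁻¹, hN.conj_mem _ n.2 s⟩)
    (hpow : S ^ e = τ ⟨s ^ (e : ℤ), (hord e).mpr (dvd_refl _)⟩) :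
    ∃ Θ : G →* T, (∀ n : N, Θ n = τ n) ∧ Θ s = S := by
  classical
  -- conjugates of elements of `N` by powers of `s`, as elements of `N`
  have hmem : ∀ (k : ℤ) (n : N), s ^ k * n * (s ^ k)⁻¹ ∈ N := fun k n => hN.conj_mem _ n.2 _
  -- compatibility of `τ` with conjugation by all powers of `s`
  have hconj' : ∀ (k : ℤ) (n : N), τ ⟨s ^ k * n * (s ^ k)⁻¹, hmem k n⟩ = S ^ k * τ n * (S ^ k)⁻¹ := by
    intro k
    induction k using Int.induction_on with
    | zero => intro n; simp
    | succ k ih =>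
      intro n
      have h1 : s ^ ((k : ℤ) + 1) * n * (s ^ ((k : ℤ) + 1))⁻¹ =
          s * (s ^ (k : ℤ) * n * (s ^ (k : ℤ))⁻¹) * s⁻¹ := by
        rw [zpow_add_one]; group
      have h2 := hconj ⟨s ^ (k : ℤ) * n * (s ^ (k : ℤ))⁻¹, hmem k n⟩
      rw [ih n] at h2
      have h3 : (⟨s ^ ((k : ℤ) + 1) * n * (s ^ ((k : ℤ) + 1))⁻¹, hmem _ n⟩ : N) =
          ⟨s * ((⟨s ^ (k : ℤ) * n * (s ^ (k : ℤ))⁻¹, hmem k n⟩ : N) : G) * s⁻¹,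
            hN.conj_mem _ (hmem k n) s⟩ := Subtype.ext h1
      rw [h3, ← h2, zpow_add_one]
      group
    | pred k ih =>
      intro n
      -- from `hconj` with `n := s⁻¹ m s`: `S⁻¹ τ(m) S = τ(s⁻¹ m s)`
      have hmem' : ∀ m : N, s⁻¹ * m * s ∈ N := fun m => by
        simpa using hN.conj_mem _ m.2 s⁻¹
      have hinv : ∀ m : N, S⁻¹ * τ m * S = τ ⟨s⁻¹ * m * s, hmem' m⟩ := by
        intro m
        have h2 := hconj ⟨s⁻¹ * m * s, hmem' m⟩
        have hm : (⟨s * ((⟨s⁻¹ * m * s, hmem' m⟩ : N) : G) * s⁻¹,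
            hN.conj_mem _ (hmem' m) s⟩ : N) = m := Subtype.ext (by simp; group)
        rw [hm] at h2
        rw [← h2]; group
      have h1 : s ^ (-(k : ℤ) - 1) * n * (s ^ (-(k : ℤ) - 1))⁻¹ =
          s⁻¹ * (s ^ (-(k : ℤ)) * n * (s ^ (-(k : ℤ)))⁻¹) * s := by
        rw [zpow_sub_one]; group
      have h2 := hinv ⟨s ^ (-(k : ℤ)) * n * (s ^ (-(k : ℤ)))⁻¹, hmem _ n⟩
      rw [ih n] at h2
      have h3 : (⟨s ^ (-(k : ℤ) - 1) * n * (s ^ (-(k : ℤ) - 1))⁻¹, hmem _ n⟩ : N) =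
          ⟨s⁻¹ * ((⟨s ^ (-(k : ℤ)) * n * (s ^ (-(k : ℤ)))⁻¹, hmem _ n⟩ : N) : G) * s,
            hmem' _⟩ := Subtype.ext h1
      rw [h3, ← h2, zpow_sub_one]
      group
  -- the two lifts from the semidirect product `N ⋊ ℤ`
  have hφ : ∀ (k : Multiplicative ℤ) (n : N), (zpowConj N s k n : N) =
      ⟨s ^ k.toAdd * n * (s ^ k.toAdd)⁻¹, hmem _ n⟩ := fun k n =>
    Subtype.ext (zpowConj_apply_coe N s k n)
  let Θ' : N ⋊[zpowConj N s] Multiplicative ℤ →* T :=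
    SemidirectProduct.lift τ (zpowersHom T S) (fun k => by
      ext n
      simp only [MonoidHom.coe_comp, MulEquiv.coe_toMonoidHom, Function.comp_apply,
        MulAut.conj_apply, zpowersHom_apply]
      rw [hφ, hconj'])
  let π : N ⋊[zpowConj N s] Multiplicative ℤ →* G :=
    SemidirectProduct.lift N.subtype (zpowersHom G s) (fun k => by
      ext n
      simp only [MonoidHom.coe_comp, MulEquiv.coe_toMonoidHom, Function.comp_apply,
        MulAut.conj_apply, zpowersHom_apply, Subgroup.coe_subtype]
      rw [hφ])
  have hπ_apply : ∀ (n : N) (k : Multiplicative ℤ), π ⟨n, k⟩ = (n : G) * s ^ k.toAdd := by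
    intro n k
    simp [π, SemidirectProduct.lift]
  have hΘ'_apply : ∀ (n : N) (k : Multiplicative ℤ), Θ' ⟨n, k⟩ = τ n * S ^ k.toAdd := by
    intro n k
    simp [Θ', SemidirectProduct.lift]
  have hπsurj : Function.Surjective π := by
    intro g
    obtain ⟨k, n, hn, rfl⟩ := hgen g
    exact ⟨⟨⟨n, hn⟩, ofAdd k⟩, by rw [hπ_apply]; rfl⟩
  have hker : π.ker ≤ Θ'.ker := by
    rintro ⟨n, k⟩ hx
    rw [MonoidHom.mem_ker] at hx ⊢
    rw [hπ_apply] at hx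
    have hsk' : s ^ k.toAdd = (n : G)⁻¹ := eq_inv_of_mul_eq_one_right hx
    have hsk : s ^ k.toAdd ∈ N := by rw [hsk']; exact N.inv_mem n.2
    obtain ⟨m, hm⟩ := (hord _).mp hsk
    have hS : S ^ k.toAdd = τ ⟨s ^ k.toAdd, hsk⟩ := by
      have h2 : S ^ k.toAdd = (S ^ e) ^ m := by rw [← zpow_natCast, ← zpow_mul, ← hm]
      rw [h2, hpow, ← map_zpow]
      congr 1
      ext
      simp only [SubgroupClass.coe_zpow, hm, zpow_mul, zpow_natCast]
    rw [hΘ'_apply, hS, ← map_mul]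
    have h1 : n * (⟨s ^ k.toAdd, hsk⟩ : N) = 1 := Subtype.ext hx
    rw [h1, map_one]
  -- descend `Θ'` along the surjection `π`
  obtain ⟨σ, hσ⟩ : ∃ σ : G → N ⋊[zpowConj N s] Multiplicative ℤ, Function.RightInverse σ π :=
    ⟨_, Function.rightInverse_surjInv hπsurj⟩
  refine ⟨π.liftOfRightInverse σ hσ ⟨Θ', hker⟩, fun n => ?_, ?_⟩
  · have h1 := π.liftOfRightInverse_comp_apply σ hσ ⟨Θ', hker⟩ ⟨n, 1⟩
    rw [hπ_apply, hΘ'_apply] at h1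
    simpa using h1
  · have h1 := π.liftOfRightInverse_comp_apply σ hσ ⟨Θ', hker⟩ ⟨1, ofAdd (1 : ℤ)⟩
    rw [hπ_apply, hΘ'_apply] at h1
    simpa using h1

end Literature.RepresentationTheory.FiniteGroups

/-! ### Additivity of codimensions of fixed spaces -/

open Module

namespace Literature.RepresentationTheory.FiniteGroups

namespace Representation

variable {A : Type*} [Field A] {G : Type*} [Group G] {F : Type*} [AddCommGroup F] [Module A F]

/-- Explicit formula for Mathlib's `Representation.averageMap`: `v ↦ #H⁻¹ Σ_h ρ(h) v`.
Ref: Serre, *Linear Representations of Finite Groups* (1977), §2.6 (projection onto invariants).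
[cite: SerreLinearRepresentations1977, §2.6] -/
theorem averageMap_apply {H : Type*} [Group H] [Fintype H] [Invertible (Fintype.card H : A)]
    (ρ : _root_.Representation A H F) (v : F) :
    ρ.averageMap v = ⅟(Fintype.card H : A) • ∑ h : H, ρ h v := by
  simp [_root_.Representation.averageMap, GroupAlgebra.average, map_sum, LinearMap.sum_apply,
    LinearMap.smul_apply]

/-- The fixed space of a subrepresentation `E` under `H` is `E ∩ F^H`.
Ref: Serre, *Local Fields* (1979), Ch. VI §2, Cor. 1' (the spaces `V^{G_i}`). [folklore] -/
theorem mem_fixedSubmodule_toRepresentation (τ : _root_.Representation A G F)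
    (E : Subrepresentation τ) (H : Subgroup G) (v : E.toSubmodule) :
    v ∈ Literature.NumberTheory.GaloisRepresentations.Representation.fixedSubmodule E.toRepresentation H ↔ (v : F) ∈ Literature.NumberTheory.GaloisRepresentations.Representation.fixedSubmodule τ H := by
  simp only [Literature.NumberTheory.GaloisRepresentations.Representation.mem_fixedSubmodule]
  refine ⟨fun h g hg => ?_, fun h g hg => ?_⟩
  · have := congrArg (fun w : E.toSubmodule => (w : F)) (h g hg)
    simpa [Subrepresentation.toRepresentation] using this
  · apply Subtype.ext
    simpa [Subrepresentation.toRepresentation] using h g hg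

/-- The `G`-stability hypothesis of Mathlib's `Representation.quotient` for a subrepresentation. [folklore] -/
theorem Subrepresentation.le_comap (τ : _root_.Representation A G F) (E : Subrepresentation τ)
    (g : G) : E.toSubmodule ≤ E.toSubmodule.comap (τ g) := fun _ hv => E.apply_mem_toSubmodule g hv

/-- `dim (p ∩ q)` computed inside `q`: `finrank (p.comap q.subtype) = finrank (p ⊓ q)`. [folklore] -/
theorem finrank_comap_subtype_eq (p q : Submodule A F) :
    finrank A (p.comap q.subtype) = finrank A (p ⊓ q : Submodule A F) := by
  have h1 : p.comap q.subtype = (p ⊓ q).comap q.subtype := by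
    rw [Submodule.comap_inf, Submodule.comap_subtype_self, inf_top_eq]
  rw [h1]
  exact (Submodule.comapSubtypeEquivOfLe (inf_le_right : p ⊓ q ≤ q)).finrank_eq

/-- **Exactness of `H`-invariants for `#H` invertible**: `dim F^H = dim E^H + dim (F/E)^H` for a
`G`-stable subspace `E` and a finite subgroup `H ≤ G` whose order is invertible in the field `A`
(the map `F^H → (F/E)^H` is onto by averaging over `H`, with kernel `E^H`).
Ref: Serre, *Linear Representations of Finite Groups* (1977), §2.6 (averaging projector) and
§14.4 (exactness in characteristic prime to `#H`). [cite: SerreLinearRepresentations1977, §2.6 and §14.4] -/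
theorem finrank_fixedSubmodule_eq_add [FiniteDimensional A F] (τ : _root_.Representation A G F)
    (H : Subgroup G) [Finite H] (hH : (Nat.card H : A) ≠ 0) (E : Subrepresentation τ) :
    finrank A (Literature.NumberTheory.GaloisRepresentations.Representation.fixedSubmodule τ H) =
      finrank A (Literature.NumberTheory.GaloisRepresentations.Representation.fixedSubmodule E.toRepresentation H) +
        finrank A (Literature.NumberTheory.GaloisRepresentations.Representation.fixedSubmodule (τ.quotient E.toSubmodule (Subrepresentation.le_comap τ E)) H) := by
  classical
  haveI : Fintype H := Fintype.ofFinite H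
  have hcard : (Fintype.card H : A) ≠ 0 := by rwa [← Nat.card_eq_fintype_card]
  haveI : Invertible (Fintype.card H : A) := invertibleOfNonzero hcard
  set W := E.toSubmodule with hW
  set τq := τ.quotient W (Subrepresentation.le_comap τ E) with hτq
  -- the map `F^H → F/E`
  let f : Literature.NumberTheory.GaloisRepresentations.Representation.fixedSubmodule τ H →ₗ[A] F ⧸ W := W.mkQ ∘ₗ (Literature.NumberTheory.GaloisRepresentations.Representation.fixedSubmodule τ H).subtype
  have hrn := LinearMap.finrank_range_add_finrank_ker f
  -- its range is `(F/E)^H`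
  have hrange : LinearMap.range f = Literature.NumberTheory.GaloisRepresentations.Representation.fixedSubmodule τq H := by
    apply le_antisymm
    · rintro _ ⟨v, rfl⟩
      rw [Literature.NumberTheory.GaloisRepresentations.Representation.mem_fixedSubmodule]
      intro h hh
      have hv := (Literature.NumberTheory.GaloisRepresentations.Representation.mem_fixedSubmodule τ H v).mp v.2 h hh
      change Submodule.mapQ W W (τ h) (Subrepresentation.le_comap τ E h) (W.mkQ v) = W.mkQ v
      simp only [Submodule.mkQ_apply, Submodule.mapQ_apply, hv]
    · intro x hx
      obtain ⟨y, rfl⟩ := W.mkQ_surjective x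
      -- average `y` over `H`
      let τH : _root_.Representation A H F := τ.comp H.subtype
      refine ⟨⟨τH.averageMap y, ?_⟩, ?_⟩
      · rw [Literature.NumberTheory.GaloisRepresentations.Representation.mem_fixedSubmodule]
        intro h hh
        exact τH.averageMap_invariant y ⟨h, hh⟩
      · change W.mkQ (τH.averageMap y) = W.mkQ y
        have hfix : ∀ h : H, W.mkQ (τH h y) = W.mkQ y := fun h =>
          (Literature.NumberTheory.GaloisRepresentations.Representation.mem_fixedSubmodule τq H _).mp hx h h.2
        rw [averageMap_apply, map_smul, map_sum]
        simp only [hfix, Finset.sum_const, Finset.card_univ]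
        rw [← Nat.cast_smul_eq_nsmul A, smul_smul, invOf_mul_self, one_smul]
  -- its kernel is `E^H = F^H ∩ E`
  have hker : finrank A (LinearMap.ker f) = finrank A (Literature.NumberTheory.GaloisRepresentations.Representation.fixedSubmodule E.toRepresentation H) := by
    have h1 : LinearMap.ker f = W.comap (Literature.NumberTheory.GaloisRepresentations.Representation.fixedSubmodule τ H).subtype := by
      ext v
      simp only [LinearMap.mem_ker, Submodule.mem_comap, Submodule.subtype_apply, f,
        LinearMap.coe_comp, Function.comp_apply, Submodule.mkQ_apply, Submodule.Quotient.mk_eq_zero]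
    have h2 : Literature.NumberTheory.GaloisRepresentations.Representation.fixedSubmodule E.toRepresentation H = (Literature.NumberTheory.GaloisRepresentations.Representation.fixedSubmodule τ H).comap W.subtype := by
      ext v
      rw [mem_fixedSubmodule_toRepresentation, Submodule.mem_comap, Submodule.subtype_apply]
    rw [h1, h2, finrank_comap_subtype_eq, finrank_comap_subtype_eq, inf_comm]
  rw [← hrn, hrange, hker, add_comm]

/-- **Additivity of `codim F^H`**: for a finite subgroup `H` of order invertible in the field `A`
and a `G`-stable subspace `E` of the finite-dimensional representation `F`,
`codim F^H = codim E^H + codim (F/E)^H`.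
Ref: Serre, *Linear Representations of Finite Groups* (1977), §2.6 and §14.4.
[cite: SerreLinearRepresentations1977, §2.6 and §14.4] -/
theorem codimFixed_eq_add [FiniteDimensional A F] (τ : _root_.Representation A G F)
    (H : Subgroup G) [Finite H] (hH : (Nat.card H : A) ≠ 0) (E : Subrepresentation τ) :
    Literature.NumberTheory.GaloisRepresentations.Representation.codimFixed τ H = Literature.NumberTheory.GaloisRepresentations.Representation.codimFixed E.toRepresentation H +
      Literature.NumberTheory.GaloisRepresentations.Representation.codimFixed (τ.quotient E.toSubmodule (Subrepresentation.le_comap τ E)) H := by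
  have h := finrank_fixedSubmodule_eq_add τ H hH E
  rw [Literature.NumberTheory.GaloisRepresentations.Representation.codimFixed_eq_finrank_sub, Literature.NumberTheory.GaloisRepresentations.Representation.codimFixed_eq_finrank_sub, Literature.NumberTheory.GaloisRepresentations.Representation.codimFixed_eq_finrank_sub]
  have h1 := (Literature.NumberTheory.GaloisRepresentations.Representation.fixedSubmodule E.toRepresentation H).finrank_le
  have h2 := (Literature.NumberTheory.GaloisRepresentations.Representation.fixedSubmodule (τ.quotient E.toSubmodule (Subrepresentation.le_comap τ E)) H).finrank_le
  have h3 := E.toSubmodule.finrank_quotient_add_finrank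
  omega

end Representation

end Literature.RepresentationTheory.FiniteGroups

/-! ### Extension of scalars -/

open Module TensorProduct

namespace Literature.RepresentationTheory.FiniteGroups

section BaseChange

variable {A : Type*} [Field A] (A' : Type*) [Field A'] [Algebra A A']
  {M : Type*} [AddCommGroup M] [Module A M]

/-- `dim_{A'} (p ⊗_A A') = dim_A p` for a subspace `p` (flatness of `A'/A`).
Ref: Bourbaki, *Algèbre*, Ch. II §7 no. 7. [folklore] -/
theorem Submodule.finrank_baseChange_eq [FiniteDimensional A M] (p : Submodule A M) :
    finrank A' (p.baseChange A') = finrank A p := by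
  have hinj : Function.Injective (p.subtype.baseChange A') :=
    Module.Flat.lTensor_preserves_injective_linearMap (M := A') p.subtype p.injective_subtype
  rw [Submodule.baseChange, LinearMap.finrank_range_of_inj hinj, Module.finrank_baseChange]

/-- For an endomorphism `P`, `(range P) ⊗_A A' ≤ range (P ⊗ A')` inside `M ⊗_A A'`. [folklore] -/
theorem Submodule.baseChange_range_le (P : Module.End A M) :
    (LinearMap.range P).baseChange A' ≤ LinearMap.range (P.baseChange A') := by
  rw [Submodule.baseChange_eq_span, Submodule.span_le]
  rintro _ ⟨_, ⟨w, rfl⟩, rfl⟩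
  exact ⟨1 ⊗ₜ w, by simp [LinearMap.baseChange_tmul]⟩

/-- **The rank of an idempotent is invariant under extension of scalars**: for `P² = P` on a
finite-dimensional `A`-space `M`, `dim_{A'} range(P ⊗ A') = dim_A range(P)` (both `range P ⊗ A'`
and `range (1-P) ⊗ A'` lie in the corresponding ranges after base change, and the two ranks sum to
`dim M` before and after).  Ref: Bourbaki, *Algèbre*, Ch. II §7. [folklore] -/
theorem finrank_range_baseChange_of_isIdempotentElem [FiniteDimensional A M] (P : Module.End A M)
    (hP : IsIdempotentElem P) :
    finrank A' (LinearMap.range (P.baseChange A')) = finrank A (LinearMap.range P) := by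
  have hQ : IsIdempotentElem (1 - P) := hP.one_sub
  have hP' : IsIdempotentElem (P.baseChange A') := by
    change P.baseChange A' * P.baseChange A' = P.baseChange A'
    rw [← LinearMap.baseChange_mul, hP.eq]
  have hQ' : (1 - P).baseChange A' = 1 - P.baseChange A' := by
    have := map_sub (Module.End.baseChangeHom A A' M) 1 P
    rwa [map_one] at this
  -- rank-nullity for the idempotents
  have h1 : finrank A (LinearMap.range P) + finrank A (LinearMap.range (1 - P)) = finrank A M := by
    rw [← LinearMap.finrank_range_add_finrank_ker P, LinearMap.IsIdempotentElem.ker_eq_range hP]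
    rfl
  have h1' : finrank A' (LinearMap.range (P.baseChange A')) +
      finrank A' (LinearMap.range (1 - P.baseChange A')) = finrank A M := by
    rw [← Module.finrank_baseChange (R := A') (S := A) (M' := M),
      ← LinearMap.finrank_range_add_finrank_ker (P.baseChange A'),
      LinearMap.IsIdempotentElem.ker_eq_range hP']
    rfl
  -- the two inequalities
  have h2 : finrank A (LinearMap.range P) ≤ finrank A' (LinearMap.range (P.baseChange A')) := by
    rw [← Submodule.finrank_baseChange_eq A']
    exact Submodule.finrank_mono (Submodule.baseChange_range_le A' P)
  have h3 : finrank A (LinearMap.range (1 - P)) ≤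
      finrank A' (LinearMap.range (1 - P.baseChange A')) := by
    rw [← Submodule.finrank_baseChange_eq A', ← hQ']
    exact Submodule.finrank_mono (Submodule.baseChange_range_le A' (1 - P))
  omega

/-! #### Base change of a representation and of fixed spaces of finite subgroups -/

variable {Γ : Type*} [Group Γ]

/-- **Extension of scalars of an abstract representation** along `A → A'`:
`g ↦ ρ(g) ⊗ 1` on `A' ⊗_A M` (Mathlib's `LinearMap.baseChange`; Mathlib has no `baseChange` for
`Representation`).  Ref: Serre, *Linear Representations of Finite Groups* (1977), §12.1
(extension of the base field). [cite: SerreLinearRepresentations1977, §12.1] -/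
def Representation.baseChange' (ρ : _root_.Representation A Γ M) :
    _root_.Representation A' Γ (A' ⊗[A] M) where
  toFun g := (ρ g).baseChange A'
  map_one' := by rw [map_one]; exact LinearMap.baseChange_one A M
  map_mul' g h := by rw [map_mul]; exact LinearMap.baseChange_mul (ρ g) (ρ h)

/-- Unfolding lemma for `Representation.baseChange'`. [folklore] -/
@[simp] theorem Representation.baseChange'_apply (ρ : _root_.Representation A Γ M) (g : Γ) :
    Representation.baseChange' A' ρ g = (ρ g).baseChange A' := rfl

variable {A'}

/-- After extension of scalars, the fixed space of `H` is the range of the base change of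
Mathlib's averaging projector `(ρ.comp H.subtype).averageMap` (`Representation.averageMap`,
`isProj_averageMap`).  Ref: Serre, *Linear Representations of Finite Groups* (1977), §2.6 and §12.1.
[cite: SerreLinearRepresentations1977, §2.6] -/
theorem Representation.fixedSubmodule_baseChange'_eq (ρ : _root_.Representation A Γ M) (H : Subgroup Γ)
    [Fintype H] [Invertible (Fintype.card H : A)] :
    Literature.NumberTheory.GaloisRepresentations.Representation.fixedSubmodule (Representation.baseChange' A' ρ) H =
      LinearMap.range ((_root_.Representation.averageMap
        (ρ.comp H.subtype : _root_.Representation A H M)).baseChange A') := by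
  let ρH : _root_.Representation A H M := ρ.comp H.subtype
  set P := ρH.averageMap with hPdef
  -- the projector as an explicit sum, and its `H`-invariance
  have hP : P = ⅟(Fintype.card H : A) • ∑ h : H, ρ h :=
    LinearMap.ext fun v => by
      rw [hPdef, Representation.averageMap_apply, LinearMap.smul_apply, LinearMap.sum_apply]
      rfl
  have hmul : ∀ {g : Γ}, g ∈ H → ρ g * P = P := fun {g} hg =>
    LinearMap.ext fun v => ρH.averageMap_invariant v ⟨g, hg⟩
  apply le_antisymm
  · intro x hx
    rw [Literature.NumberTheory.GaloisRepresentations.Representation.mem_fixedSubmodule] at hx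
    refine ⟨x, ?_⟩
    have hsum : P.baseChange A' = ⅟(Fintype.card H : A) • ∑ h : H, (ρ h).baseChange A' := by
      rw [hP, LinearMap.baseChange_smul]
      congr 1
      exact map_sum (LinearMap.baseChangeHom A A' M M) _ _
    rw [hsum, LinearMap.smul_apply, LinearMap.sum_apply]
    simp only [fun h : H => show (ρ h).baseChange A' x = x from hx h h.2, Finset.sum_const,
      Finset.card_univ]
    rw [← Nat.cast_smul_eq_nsmul A, smul_smul, invOf_mul_self, one_smul]
  · rintro _ ⟨w, rfl⟩
    rw [Literature.NumberTheory.GaloisRepresentations.Representation.mem_fixedSubmodule]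
    intro h hh
    rw [Representation.baseChange'_apply, ← Module.End.mul_apply, ← LinearMap.baseChange_mul, hmul hh]

/-- **`codim F^H` is invariant under extension of scalars**, for a finite subgroup `H` whose
order is invertible in the field `A`: the fixed space is the range of Mathlib's averaging
projector `(ρ.comp H.subtype).averageMap` (`isProj_averageMap`), an idempotent whose rank does not
change under base change (`finrank_range_baseChange_of_isIdempotentElem`).
Ref: Serre, *Linear Representations of Finite Groups* (1977), §12.1 and §2.6.
[cite: SerreLinearRepresentations1977, §12.1] -/
theorem Representation.codimFixed_baseChange' [FiniteDimensional A M] (ρ : _root_.Representation A Γ M)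
    (H : Subgroup Γ) [Finite H] (hH : (Nat.card H : A) ≠ 0) :
    Literature.NumberTheory.GaloisRepresentations.Representation.codimFixed (Representation.baseChange' A' ρ) H = Literature.NumberTheory.GaloisRepresentations.Representation.codimFixed ρ H := by
  classical
  haveI : Fintype H := Fintype.ofFinite H
  have hcard : (Fintype.card H : A) ≠ 0 := by rwa [← Nat.card_eq_fintype_card]
  haveI : Invertible (Fintype.card H : A) := invertibleOfNonzero hcard
  let ρH : _root_.Representation A H M := ρ.comp H.subtype
  have hproj := ρH.isProj_averageMap
  have hfix : Literature.NumberTheory.GaloisRepresentations.Representation.fixedSubmodule ρ H = LinearMap.range ρH.averageMap := hproj.range.symm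
  rw [Literature.NumberTheory.GaloisRepresentations.Representation.codimFixed_eq_finrank_sub, Literature.NumberTheory.GaloisRepresentations.Representation.codimFixed_eq_finrank_sub,
    Representation.fixedSubmodule_baseChange'_eq ρ H, hfix,
    finrank_range_baseChange_of_isIdempotentElem A' _ hproj.isIdempotentElem,
    Module.finrank_baseChange]

end BaseChange

end Literature.RepresentationTheory.FiniteGroups

/-! ### The transfer theorem for `N ⋊_s ℤ` -/

namespace Literature.RepresentationTheory.FiniteGroups

open Multiplicative Module

section CliffordIntegrality

universe uA w

variable {A : Type uA} [Field A] {G : Type*} [Group G]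

/-- For `H ≤ N`, the subgroup `inl(H) ≤ N ⋊_s ℤ` is a copy of `H`. [folklore] -/
theorem nonempty_mulEquiv_map_inl_subgroupOf (N : Subgroup G) [N.Normal] (s : G) {H : Subgroup G}
    (h : H ≤ N) :
    Nonempty (H ≃* ((H.subgroupOf N).map
      (SemidirectProduct.inl : N →* N ⋊[zpowConj N s] Multiplicative ℤ))) :=
  ⟨(Subgroup.subgroupOfEquivOfLe h).symm.trans
    ((H.subgroupOf N).equivMapOfInjective _ SemidirectProduct.inl_injective)⟩

/-- `inl(H) ≤ N ⋊_s ℤ` is finite for finite `H ≤ N`. [folklore] -/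
theorem finite_map_inl_subgroupOf (N : Subgroup G) [N.Normal] (s : G) {H : Subgroup G}
    (h : H ≤ N) [Finite H] :
    Finite ((H.subgroupOf N).map (SemidirectProduct.inl : N →* N ⋊[zpowConj N s] Multiplicative ℤ)) := by
  obtain ⟨f⟩ := nonempty_mulEquiv_map_inl_subgroupOf N s h
  exact Finite.of_equiv _ f.toEquiv

/-- `#inl(H) = #H` for `H ≤ N`. [folklore] -/
theorem card_map_inl_subgroupOf (N : Subgroup G) [N.Normal] (s : G) {H : Subgroup G} (h : H ≤ N) :
    Nat.card ((H.subgroupOf N).map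
      (SemidirectProduct.inl : N →* N ⋊[zpowConj N s] Multiplicative ℤ)) = Nat.card H := by
  obtain ⟨f⟩ := nonempty_mulEquiv_map_inl_subgroupOf N s h
  exact (Nat.card_congr f.toEquiv).symm

/-- The element `z₀ = inl(s^e)⁻¹ · inr(e)` is central in `N ⋊_s ℤ` (it maps to `1` in
`G = N⟨s⟩`).  Ref: Isaacs, *Character Theory of Finite Groups* (1976), proof of Thm 11.22. [folklore] -/
theorem zpowConj_central (N : Subgroup G) [N.Normal] (s : G) (e : ℕ) (he : s ^ (e : ℤ) ∈ N)
    (x : N ⋊[zpowConj N s] Multiplicative ℤ) :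
    ((SemidirectProduct.inl ⟨s ^ (e : ℤ), he⟩)⁻¹ * SemidirectProduct.inr (ofAdd (e : ℤ))) * x =
      x * ((SemidirectProduct.inl ⟨s ^ (e : ℤ), he⟩)⁻¹ * SemidirectProduct.inr (ofAdd (e : ℤ))) := by
  have hφ : ∀ (k : Multiplicative ℤ) (n : N), (zpowConj N s k n : G) =
      s ^ k.toAdd * n * (s ^ k.toAdd)⁻¹ := fun k n => zpowConj_apply_coe N s k n
  refine SemidirectProduct.ext ?_ ?_
  · apply Subtype.ext
    simp only [SemidirectProduct.mul_left, SemidirectProduct.inv_left, SemidirectProduct.left_inl,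
      SemidirectProduct.right_inl, SemidirectProduct.left_inr, SemidirectProduct.right_inr,
      SemidirectProduct.mul_right, SemidirectProduct.inv_right, inv_one, map_one, MulAut.one_apply,
      mul_one, one_mul, Subgroup.coe_mul, InvMemClass.coe_inv, hφ, toAdd_ofAdd]
    group
  · simp only [SemidirectProduct.mul_right, SemidirectProduct.inv_right, SemidirectProduct.right_inl,
      SemidirectProduct.right_inr, inv_one, one_mul]
    exact mul_comm _ _

/-- **Integrality transfer across a cyclic extension (algebraically closed coefficients).**  Let
`N ⊲ G` with `G = N⟨s⟩`, `s ^ k ∈ N ↔ e ∣ k` (`e > 0`), and let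
`b(τ) = Σ_{i ∈ I} c_i · codim F^{τ(H_i)}` for finite subgroups `H_i ≤ N` of order invertible in the
algebraically closed field `A`.  If `b(Θ|_N) ∈ ℕ` for every finite-dimensional representation `Θ`
of `G` (hypothesis `hint`; in the application, Artin's theorem for `G = G_0`), then `b(ρ ∘ inl) ∈ ℕ`
for every finite-dimensional representation `ρ` of `N ⋊_s ℤ`.  Proof by induction on `dim F`:
`z₀ = inl(s^e)⁻¹ inr(e)` is central (`zpowConj_central`), so an eigenspace of `ρ z₀` is a
subrepresentation; if proper, conclude by additivity (`Representation.codimFixed_eq_add`); if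
`ρ z₀ = μ` is a scalar (`μ ≠ 0`), put `S = c · ρ(inr 1)` with `c ^ e = μ⁻¹`: then `S ^ e = ρ(inl s^e)`
and `S` conjugates `ρ ∘ inl` as `s` does, so `ρ ∘ inl` extends to `G`
(`MonoidHom.exists_extend_of_cyclic_quotient`) with the same fixed spaces under the `H_i`.
Ref: Isaacs, *Character Theory of Finite Groups* (1976), Thm 11.22 (extension across cyclic
quotients); Serre, *Linear Representations of Finite Groups* (1977), §19.3 (the integer `b(M)`);
Katz, *Gauss sums, Kloosterman sums, and monodromy groups* (1988), Ch. 1, 1.8–1.10.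
[cite: SerreLinearRepresentations1977, §19.3] [cite: Katz1988, Ch. 1, 1.8–1.10] -/
theorem clifford_integrality_of_isAlgClosed [IsAlgClosed A] (N : Subgroup G) [hN : N.Normal]
    (s : G) (e : ℕ) (he : 0 < e)
    (hgen : ∀ g : G, ∃ (k : ℤ) (n : G), n ∈ N ∧ g = n * s ^ k)
    (hord : ∀ k : ℤ, s ^ k ∈ N ↔ (e : ℤ) ∣ k)
    {ι : Type*} (I : Finset ι) (c : ι → ℝ) (H : ι → Subgroup G)
    (hHN : ∀ i ∈ I, H i ≤ N) (hfin : ∀ i ∈ I, Finite (H i))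
    (hcard : ∀ i ∈ I, (Nat.card (H i) : A) ≠ 0)
    (hint : ∀ (F : Type w) [AddCommGroup F] [Module A F] [FiniteDimensional A F]
      (Θ : Representation A G F),
      ∃ n : ℕ, (n : ℝ) = ∑ i ∈ I, c i * Literature.NumberTheory.GaloisRepresentations.Representation.codimFixed Θ (H i))
    {F : Type w} [AddCommGroup F] [Module A F] [FiniteDimensional A F]
    (ρ : Representation A (N ⋊[zpowConj N s] Multiplicative ℤ) F) :
    ∃ n : ℕ, (n : ℝ) = ∑ i ∈ I, c i *
      Literature.NumberTheory.GaloisRepresentations.Representation.codimFixed ρ (((H i).subgroupOf N).map SemidirectProduct.inl) := by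
  classical
  have hse : s ^ (e : ℤ) ∈ N := (hord e).mpr (dvd_refl _)
  -- notation
  set Γ := N ⋊[zpowConj N s] Multiplicative ℤ
  set z₀ : N ⋊[zpowConj N s] Multiplicative ℤ :=
    (SemidirectProduct.inl ⟨s ^ (e : ℤ), hse⟩)⁻¹ * SemidirectProduct.inr (ofAdd (e : ℤ)) with hz₀
  have hcentral : ∀ x, z₀ * x = x * z₀ := zpowConj_central N s e hse
  set Hm : ι → Subgroup (N ⋊[zpowConj N s] Multiplicative ℤ) :=
    fun i => ((H i).subgroupOf N).map SemidirectProduct.inl with hHm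
  -- the subgroups `Hm i` are finite of invertible order
  have hHm_equiv : ∀ i ∈ I, Nonempty (H i ≃* Hm i) := fun i hi =>
    ⟨(Subgroup.subgroupOfEquivOfLe (hHN i hi)).symm.trans
      (((H i).subgroupOf N).equivMapOfInjective _ SemidirectProduct.inl_injective)⟩
  have hHm_fin : ∀ i ∈ I, Finite (Hm i) := fun i hi => by
    haveI := hfin i hi
    obtain ⟨f⟩ := hHm_equiv i hi
    exact Finite.of_equiv _ f.toEquiv
  have hHm_card : ∀ i ∈ I, (Nat.card (Hm i) : A) ≠ 0 := fun i hi => by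
    obtain ⟨f⟩ := hHm_equiv i hi
    rw [← Nat.card_congr f.toEquiv]
    exact hcard i hi
  -- strong induction on the dimension
  suffices key : ∀ (d : ℕ) (V : Type w) [AddCommGroup V] [Module A V] [FiniteDimensional A V]
      (τ : Representation A (N ⋊[zpowConj N s] Multiplicative ℤ) V), finrank A V = d →
      ∃ n : ℕ, (n : ℝ) = ∑ i ∈ I, c i * Literature.NumberTheory.GaloisRepresentations.Representation.codimFixed τ (Hm i) from
    key _ F ρ rfl
  intro d
  induction d using Nat.strong_induction_on with
  | _ d ih =>
  intro V _ _ _ τ hd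
  rcases subsingleton_or_nontrivial V with hV | hV
  · -- trivial space: all codimensions vanish
    refine ⟨0, ?_⟩
    rw [Nat.cast_zero, eq_comm]
    refine Finset.sum_eq_zero fun i _ => ?_
    rw [Literature.NumberTheory.GaloisRepresentations.Representation.codimFixed, finrank_zero_of_subsingleton, Nat.cast_zero, mul_zero]
  -- an eigenvalue of the central element
  obtain ⟨μ, hμ⟩ := Module.End.exists_eigenvalue (τ z₀)
  have hstab : ∀ (g : N ⋊[zpowConj N s] Multiplicative ℤ) ⦃v : V⦄,
      v ∈ Module.End.eigenspace (τ z₀) μ → τ g v ∈ Module.End.eigenspace (τ z₀) μ := by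
    intro g v hv
    rw [Module.End.mem_eigenspace_iff] at hv ⊢
    rw [← Module.End.mul_apply, ← map_mul, hcentral, map_mul, Module.End.mul_apply, hv, map_smul]
  let E : Subrepresentation τ := ⟨Module.End.eigenspace (τ z₀) μ, hstab⟩
  have hEbot : E.toSubmodule ≠ ⊥ := hμ
  by_cases htop : E.toSubmodule = ⊤
  · ----------------------------------------------------------------
    -- scalar case: `τ z₀ = μ • 1`; build a `G`-representation extending `τ ∘ inl`
    have hz : ∀ v : V, τ z₀ v = μ • v := fun v => by
      have hv : v ∈ E.toSubmodule := htop ▸ Submodule.mem_top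
      exact Module.End.mem_eigenspace_iff.mp hv
    -- `μ ≠ 0` since `τ z₀` is invertible
    have hμ0 : μ ≠ 0 := by
      intro h0
      obtain ⟨v, hv⟩ := exists_ne (0 : V)
      have : τ z₀⁻¹ (τ z₀ v) = v := by
        rw [← Module.End.mul_apply, ← map_mul, inv_mul_cancel, map_one, Module.End.one_apply]
      rw [hz, h0, zero_smul, map_zero] at this
      exact hv this.symm
    obtain ⟨cA, hcA⟩ := IsAlgClosed.exists_pow_nat_eq μ⁻¹ he
    have hcA0 : cA ≠ 0 := by
      rintro rfl
      rw [zero_pow he.ne'] at hcA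
      exact inv_ne_zero hμ0 hcA.symm
    -- the unit `S = cA • τ(inr 1)`
    set x₁ : N ⋊[zpowConj N s] Multiplicative ℤ := SemidirectProduct.inr (ofAdd (1 : ℤ)) with hx₁
    let S : (V →ₗ[A] V)ˣ :=
      ⟨cA • τ x₁, cA⁻¹ • τ x₁⁻¹,
        by rw [smul_mul_smul_comm, mul_inv_cancel₀ hcA0, one_smul, ← map_mul, mul_inv_cancel, map_one],
        by rw [smul_mul_smul_comm, inv_mul_cancel₀ hcA0, one_smul, ← map_mul, inv_mul_cancel, map_one]⟩
    let τu : N →* (V →ₗ[A] V)ˣ := (τ.comp SemidirectProduct.inl).toHomUnits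
    have hτu : ∀ n : N, (τu n : V →ₗ[A] V) = τ (SemidirectProduct.inl n) := fun n => rfl
    -- conjugation relation
    have hφ1 : ∀ n : N, zpowConj N s (ofAdd (1 : ℤ)) n = ⟨s * n * s⁻¹, hN.conj_mem _ n.2 s⟩ :=
      fun n => Subtype.ext (by rw [zpowConj_apply_coe]; simp)
    have hconj : ∀ n : N, S * τu n * S⁻¹ = τu ⟨s * n * s⁻¹, hN.conj_mem _ n.2 s⟩ := by
      intro n
      ext1
      change (cA • τ x₁) * τ (SemidirectProduct.inl n) * (cA⁻¹ • τ x₁⁻¹) =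
        τ (SemidirectProduct.inl ⟨s * n * s⁻¹, _⟩)
      have h1 : (cA • τ x₁) * τ (SemidirectProduct.inl n) * (cA⁻¹ • τ x₁⁻¹) =
          τ x₁ * τ (SemidirectProduct.inl n) * τ x₁⁻¹ := by
        simp only [smul_mul_assoc, mul_smul_comm, smul_smul, inv_mul_cancel₀ hcA0, one_smul]
      rw [h1, ← map_mul, ← map_mul, hx₁, ← map_inv, ← SemidirectProduct.inl_aut, hφ1]
    -- power relation
    have hxe : x₁ ^ e = SemidirectProduct.inl ⟨s ^ (e : ℤ), hse⟩ * z₀ := by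
      rw [hz₀, mul_inv_cancel_left, hx₁, ← map_pow]
      congr 1
      rw [← ofAdd_nsmul, nsmul_eq_mul, mul_one]
    have hzμ : τ z₀ = μ • (1 : V →ₗ[A] V) := LinearMap.ext fun v => by simp [hz v]
    have hpow : S ^ e = τu ⟨s ^ (e : ℤ), hse⟩ := by
      ext1
      rw [Units.val_pow_eq_pow_val]
      change (cA • τ x₁) ^ e = τ (SemidirectProduct.inl ⟨s ^ (e : ℤ), hse⟩)
      rw [smul_pow, ← map_pow, hxe, map_mul, hzμ, hcA, mul_smul_comm, mul_one, smul_smul,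
        inv_mul_cancel₀ hμ0, one_smul]
    obtain ⟨Θu, hΘN, hΘs⟩ :=
      MonoidHom.exists_extend_of_cyclic_quotient N s e hgen hord τu S hconj hpow
    let Θ : Representation A G V := (Units.coeHom (V →ₗ[A] V)).comp Θu
    have hΘ : ∀ n : N, Θ n = τ (SemidirectProduct.inl n) := fun n => by
      change ((Θu n : (V →ₗ[A] V)ˣ) : V →ₗ[A] V) = _
      rw [hΘN n, hτu]
    obtain ⟨n, hn⟩ := hint V Θ
    refine ⟨n, hn.trans (Finset.sum_congr rfl fun i hi => ?_)⟩
    -- the fixed spaces agree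
    have hfix : Literature.NumberTheory.GaloisRepresentations.Representation.fixedSubmodule Θ (H i) = Literature.NumberTheory.GaloisRepresentations.Representation.fixedSubmodule τ (Hm i) := by
      ext v
      simp only [Literature.NumberTheory.GaloisRepresentations.Representation.mem_fixedSubmodule]
      constructor
      · rintro hv _ ⟨m, hm, rfl⟩
        rw [← hΘ]
        exact hv _ (Subgroup.mem_subgroupOf.mp hm)
      · intro hv h hh
        have := hv (SemidirectProduct.inl ⟨h, hHN i hi hh⟩)
          ⟨⟨h, hHN i hi hh⟩, Subgroup.mem_subgroupOf.mpr hh, rfl⟩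
        rwa [← hΘ] at this
    rw [Literature.NumberTheory.GaloisRepresentations.Representation.codimFixed, Literature.NumberTheory.GaloisRepresentations.Representation.codimFixed, hfix]
  · ----------------------------------------------------------------
    -- proper case: induct on the eigenspace and the quotient
    have hE_lt : finrank A E.toSubmodule < d := hd ▸ Submodule.finrank_lt htop
    have hE_pos : 0 < finrank A E.toSubmodule := by
      rw [pos_iff_ne_zero, Ne, Submodule.finrank_eq_zero]
      exact hEbot
    have hQ := E.toSubmodule.finrank_quotient_add_finrank
    have hQ_lt : finrank A (V ⧸ E.toSubmodule) < d := by omega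
    obtain ⟨n₁, hn₁⟩ := ih _ hE_lt E.toSubmodule E.toRepresentation rfl
    obtain ⟨n₂, hn₂⟩ := ih _ hQ_lt (V ⧸ E.toSubmodule)
      (τ.quotient E.toSubmodule (Representation.Subrepresentation.le_comap τ E)) rfl
    refine ⟨n₁ + n₂, ?_⟩
    rw [Nat.cast_add, hn₁, hn₂, ← Finset.sum_add_distrib]
    refine Finset.sum_congr rfl fun i hi => ?_
    haveI := hHm_fin i hi
    rw [Representation.codimFixed_eq_add τ (Hm i) (hHm_card i hi) E, Nat.cast_add, mul_add]

/-- **Integrality transfer across a cyclic extension (any field of coefficients).**  As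
`clifford_integrality_of_isAlgClosed`, over an arbitrary field `A`, with the hypothesis on the
representations of `G` required over the algebraic closure `Ā` of `A` (on spaces of universe
`max uA w`): extension of scalars to `Ā` does not change the codimensions
(`Representation.codimFixed_baseChange'`).
Ref: Isaacs, *Character Theory of Finite Groups* (1976), Thm 11.22; Serre, *Linear Representations
of Finite Groups* (1977), §12.1 and §19.3. [cite: SerreLinearRepresentations1977, §12.1 and §19.3] -/
theorem clifford_integrality (N : Subgroup G) [hN : N.Normal] (s : G) (e : ℕ) (he : 0 < e)
    (hgen : ∀ g : G, ∃ (k : ℤ) (n : G), n ∈ N ∧ g = n * s ^ k)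
    (hord : ∀ k : ℤ, s ^ k ∈ N ↔ (e : ℤ) ∣ k)
    {ι : Type*} (I : Finset ι) (c : ι → ℝ) (H : ι → Subgroup G)
    (hHN : ∀ i ∈ I, H i ≤ N) (hfin : ∀ i ∈ I, Finite (H i))
    (hcard : ∀ i ∈ I, (Nat.card (H i) : A) ≠ 0)
    (hint : ∀ (F : Type (max uA w)) [AddCommGroup F] [Module (AlgebraicClosure A) F]
      [FiniteDimensional (AlgebraicClosure A) F] (Θ : Representation (AlgebraicClosure A) G F),
      ∃ n : ℕ, (n : ℝ) = ∑ i ∈ I, c i * Literature.NumberTheory.GaloisRepresentations.Representation.codimFixed Θ (H i))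
    {F : Type w} [AddCommGroup F] [Module A F] [FiniteDimensional A F]
    (ρ : Representation A (N ⋊[zpowConj N s] Multiplicative ℤ) F) :
    ∃ n : ℕ, (n : ℝ) = ∑ i ∈ I, c i *
      Literature.NumberTheory.GaloisRepresentations.Representation.codimFixed ρ (((H i).subgroupOf N).map SemidirectProduct.inl) := by
  have hinj : Function.Injective (algebraMap A (AlgebraicClosure A)) :=
    (algebraMap A (AlgebraicClosure A)).injective
  have hcard' : ∀ i ∈ I, (Nat.card (H i) : AlgebraicClosure A) ≠ 0 := by
    intro i hi h
    apply hcard i hi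
    apply hinj
    rw [map_natCast, map_zero, h]
  obtain ⟨n, hn⟩ := clifford_integrality_of_isAlgClosed (A := AlgebraicClosure A) N s e he hgen hord
    I c H hHN hfin hcard' hint (Representation.baseChange' (AlgebraicClosure A) ρ)
  refine ⟨n, hn.trans (Finset.sum_congr rfl fun i hi => ?_)⟩
  haveI := hfin i hi
  haveI := finite_map_inl_subgroupOf N s (hHN i hi)
  rw [Representation.codimFixed_baseChange' (A' := AlgebraicClosure A) ρ _
    (by rw [card_map_inl_subgroupOf N s (hHN i hi)]; exact hcard i hi)]

end CliffordIntegrality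

end Literature.RepresentationTheory.FiniteGroups

end
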